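import Mathlib.Algebra.Polynomial.Derivative
import Mathlib.Algebra.Polynomial.Roots
import Mathlib.Analysis.Calculus.Deriv.Polynomial
import Mathlib.Analysis.Calculus.Deriv.MeanValue
import Mathlib.Analysis.Convex.Basic
import Mathlib.Data.Sign.Defs
import Mathlib.Order.Interval.Set.Infinite
import Mathlib.Topology.Order.IntermediateValue
import Mathlib.Topology.Order.DenselyOrdered
import Mathlib.Topology.Algebra.Polynomial
import Mathlib.Topology.MetricSpace.Pseudo.Defs
import HarnessLib

/-!
# Thom's lemma for a real polynomial and all its derivatives

For a real polynomial `p` of degree `d` and a sign condition `σ : ℕ → SignType` on the family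
`p, p', p'', …, p⁽ᵈ⁾` of all its derivatives, the *Thom cell*
`{y | ∀ j ≤ d, sign (p⁽ʲ⁾(y)) = σ j}` is either empty, a point, or an open interval, and when it is
non-empty its closure is obtained by relaxing every strict sign condition `sign (p⁽ʲ⁾(y)) = σ j`
to `sign (p⁽ʲ⁾(y)) = σ j ∨ p⁽ʲ⁾(y) = 0` (Basu–Pollack–Roy 2006, Lemma 5.33 "Thom's lemma", for the
family `Der(p)`; Bochnak–Coste–Roy 1998, Prop. 2.5.4). We prove it in the form

* `Literature.ModelTheory.ExponentialFields.Thom.isPreconnected_and_closure_eq`: a non-empty Thom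
  cell is preconnected (i.e. an interval or a point) and its closure is the relaxed cell;
* `Literature.ModelTheory.ExponentialFields.Thom.eq_singleton_of_mem`: if `p ≠ 0` and `σ 0 = 0`
  (so the cell consists of roots of `p`), a non-empty cell is a single point `{y₀}` and so is the
  relaxed cell — the form used to prove continuity of a root selected by a Thom sign condition
  (`Literature/NumberTheory/Transcendental/SemialgebraicMapsSmoothProofs.lean`).

The proof is the printed induction on the degree: the cell of `p` is the cell of `p'` (for the
shifted sign condition) cut by one sign condition on `p`, and on the closure of the cell of `p'`
the polynomial `p` is strictly monotone (mean value theorem), so the elementary facts on sign sets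
of strictly monotone continuous functions on intervals (`closure_sep_pos_eq`, `closure_sep_neg_eq`,
`sep_eq_zero_eq_singleton`) apply.

## References

* S. Basu, R. Pollack, M.-F. Roy, *Algorithms in Real Algebraic Geometry*, 2nd ed., Springer
  (2006), Lemma 5.33 (Thom's lemma) and Prop. 2.27 (basic Thom's lemma).
* J. Bochnak, M. Coste, M.-F. Roy, *Real Algebraic Geometry*, Ergebnisse 36, Springer (1998),
  Prop. 2.5.4.

## Design notes

* No new definitions: the cells are written as set-builder expressions, the sign condition is an
  arbitrary `σ : ℕ → SignType` (only its values at `j ≤ natDegree p` matter).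
* Everything is over `ℝ` (Mathlib's mean value theorem); the statements over a general real closed
  field are not needed downstream.
-/

noncomputable section

open Polynomial Set Filter
open _root_.Topology

namespace Literature.ModelTheory.ExponentialFields

namespace Thom

/-! ### Sign sets of strictly monotone functions on intervals -/

section Monotone

variable {A : Set ℝ} {g : ℝ → ℝ}

/-- If `y` is in the closure of an interval `A` and `y₁ ∈ A`, then `(y, y₁] ⊆ A`. [folklore] -/
theorem Ioc_subset_of_mem_closure (hA : A.OrdConnected) {y y₁ : ℝ} (hy : y ∈ closure A)
    (hy₁ : y₁ ∈ A) : Ioc y y₁ ⊆ A := by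
  intro t ht
  obtain ⟨a, hat, haA⟩ : ∃ a, a < t ∧ a ∈ A := by
    obtain ⟨a, ha⟩ := mem_closure_iff_nhds.mp hy (Iio t) (Iio_mem_nhds ht.1)
    exact ⟨a, ha.1, ha.2⟩
  exact hA.out haA hy₁ ⟨hat.le, ht.2⟩

/-- If `y` is in the closure of an interval `A` and `y₁ ∈ A`, then `[y₁, y) ⊆ A`. [folklore] -/
theorem Ico_subset_of_mem_closure (hA : A.OrdConnected) {y y₁ : ℝ} (hy : y ∈ closure A)
    (hy₁ : y₁ ∈ A) : Ico y₁ y ⊆ A := by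
  intro t ht
  obtain ⟨a, hta, haA⟩ : ∃ a, t < a ∧ a ∈ A := by
    obtain ⟨a, ha⟩ := mem_closure_iff_nhds.mp hy (Ioi t) (Ioi_mem_nhds ht.2)
    exact ⟨a, ha.1, ha.2⟩
  exact hA.out hy₁ haA ⟨ht.1, hta.le⟩

/-- For an interval `A ⊆ ℝ`, the interior of its closure is contained in `A`. [folklore] -/
theorem interior_closure_subset (hA : A.OrdConnected) : interior (closure A) ⊆ A := by
  intro y hy
  rw [mem_interior_iff_mem_nhds, Metric.mem_nhds_iff] at hy
  obtain ⟨ε, hε, hball⟩ := hy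
  have h1 : y - ε / 2 ∈ closure A := hball (by rw [Real.ball_eq_Ioo]; constructor <;> linarith)
  have h2 : y + ε / 2 ∈ closure A := hball (by rw [Real.ball_eq_Ioo]; constructor <;> linarith)
  obtain ⟨a₁, ha₁y, ha₁A⟩ : ∃ a, a < y ∧ a ∈ A := by
    obtain ⟨a, ha⟩ := mem_closure_iff_nhds.mp h1 (Iio y) (Iio_mem_nhds (by linarith))
    exact ⟨a, ha.1, ha.2⟩
  obtain ⟨a₂, hya₂, ha₂A⟩ : ∃ a, y < a ∧ a ∈ A := by
    obtain ⟨a, ha⟩ := mem_closure_iff_nhds.mp h2 (Ioi y) (Ioi_mem_nhds (by linarith))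
    exact ⟨a, ha.1, ha.2⟩
  exact hA.out ha₁A ha₂A ⟨ha₁y.le, hya₂.le⟩

/-- For `g` strictly increasing on the closure of an interval `A`, the positivity set
`{y ∈ A | 0 < g y}` is an interval. [folklore] -/
theorem ordConnected_sep_pos (hA : A.OrdConnected) (hmono : StrictMonoOn g (closure A)) :
    {y ∈ A | 0 < g y}.OrdConnected :=
  ⟨fun _ ha _ hb _ ht => ⟨hA.out ha.1 hb.1 ht, ha.2.trans_le
    (hmono.monotoneOn (subset_closure ha.1) (subset_closure (hA.out ha.1 hb.1 ht)) ht.1)⟩⟩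

/-- For `g` strictly increasing on the closure of an interval `A`, the negativity set
`{y ∈ A | g y < 0}` is an interval. [folklore] -/
theorem ordConnected_sep_neg (hA : A.OrdConnected) (hmono : StrictMonoOn g (closure A)) :
    {y ∈ A | g y < 0}.OrdConnected :=
  ⟨fun _ ha _ hb _ ht => ⟨hA.out ha.1 hb.1 ht,
    (hmono.monotoneOn (subset_closure (hA.out ha.1 hb.1 ht)) (subset_closure hb.1) ht.2).trans_lt
      hb.2⟩⟩

/-- For `g` continuous and strictly increasing on the closure of an interval `A`, the closure of a
non-empty positivity set `{y ∈ A | 0 < g y}` is `{y ∈ closure A | 0 ≤ g y}`. [folklore] -/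
theorem closure_sep_pos_eq (hA : A.OrdConnected) (hg : Continuous g)
    (hmono : StrictMonoOn g (closure A)) (hne : {y ∈ A | 0 < g y}.Nonempty) :
    closure {y ∈ A | 0 < g y} = {y ∈ closure A | 0 ≤ g y} := by
  obtain ⟨y₁, hy₁A, hy₁⟩ := hne
  apply Subset.antisymm
  · have hcl : IsClosed {y ∈ closure A | 0 ≤ g y} :=
      isClosed_closure.inter (isClosed_le continuous_const hg)
    exact hcl.closure_subset_iff.mpr fun y hy => ⟨subset_closure hy.1, hy.2.le⟩
  · rintro y ⟨hy, hgy⟩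
    rcases lt_trichotomy y y₁ with h | rfl | h
    · have hsub : Ioc y y₁ ⊆ {y ∈ A | 0 < g y} := fun t ht =>
        ⟨Ioc_subset_of_mem_closure hA hy hy₁A ht, hgy.trans_lt
          (hmono hy (subset_closure (Ioc_subset_of_mem_closure hA hy hy₁A ht)) ht.1)⟩
      have hmem : y ∈ closure (Ioc y y₁) := by
        rw [closure_Ioc h.ne]
        exact left_mem_Icc.mpr h.le
      exact closure_mono hsub hmem
    · exact subset_closure ⟨hy₁A, hy₁⟩
    · have hsub : Ico y₁ y ⊆ {y ∈ A | 0 < g y} := fun t ht =>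
        ⟨Ico_subset_of_mem_closure hA hy hy₁A ht, hy₁.trans_le
          (hmono.monotoneOn (subset_closure hy₁A)
            (subset_closure (Ico_subset_of_mem_closure hA hy hy₁A ht)) ht.1)⟩
      have hmem : y ∈ closure (Ico y₁ y) := by
        rw [closure_Ico h.ne]
        exact right_mem_Icc.mpr h.le
      exact closure_mono hsub hmem

/-- For `g` continuous and strictly increasing on the closure of an interval `A`, the closure of a
non-empty negativity set `{y ∈ A | g y < 0}` is `{y ∈ closure A | g y ≤ 0}`. [folklore] -/
theorem closure_sep_neg_eq (hA : A.OrdConnected) (hg : Continuous g)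
    (hmono : StrictMonoOn g (closure A)) (hne : {y ∈ A | g y < 0}.Nonempty) :
    closure {y ∈ A | g y < 0} = {y ∈ closure A | g y ≤ 0} := by
  obtain ⟨y₁, hy₁A, hy₁⟩ := hne
  apply Subset.antisymm
  · have hcl : IsClosed {y ∈ closure A | g y ≤ 0} :=
      isClosed_closure.inter (isClosed_le hg continuous_const)
    exact hcl.closure_subset_iff.mpr fun y hy => ⟨subset_closure hy.1, hy.2.le⟩
  · rintro y ⟨hy, hgy⟩
    rcases lt_trichotomy y y₁ with h | rfl | h
    · have hsub : Ioc y y₁ ⊆ {y ∈ A | g y < 0} := fun t ht =>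
        ⟨Ioc_subset_of_mem_closure hA hy hy₁A ht,
          (hmono.monotoneOn (subset_closure (Ioc_subset_of_mem_closure hA hy hy₁A ht))
            (subset_closure hy₁A) ht.2).trans_lt hy₁⟩
      have hmem : y ∈ closure (Ioc y y₁) := by
        rw [closure_Ioc h.ne]
        exact left_mem_Icc.mpr h.le
      exact closure_mono hsub hmem
    · exact subset_closure ⟨hy₁A, hy₁⟩
    · have hsub : Ico y₁ y ⊆ {y ∈ A | g y < 0} := fun t ht =>
        ⟨Ico_subset_of_mem_closure hA hy hy₁A ht,
          (hmono (subset_closure (Ico_subset_of_mem_closure hA hy hy₁A ht)) hy ht.2).trans_le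
            hgy⟩
      have hmem : y ∈ closure (Ico y₁ y) := by
        rw [closure_Ico h.ne]
        exact right_mem_Icc.mpr h.le
      exact closure_mono hsub hmem

/-- For `g` strictly increasing on the closure of `A` with a zero `y₀ ∈ A`, both the zero set of `g`
in `A` and the zero set of `g` in `closure A` are `{y₀}`. [folklore] -/
theorem sep_eq_zero_eq_singleton (hmono : StrictMonoOn g (closure A)) {y₀ : ℝ} (hy₀A : y₀ ∈ A)
    (hy₀ : g y₀ = 0) :
    {y ∈ A | g y = 0} = {y₀} ∧ {y ∈ closure A | g y = 0} = {y₀} := by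
  have key : ∀ y ∈ closure A, g y = 0 → y = y₀ := fun y hy h =>
    hmono.injOn hy (subset_closure hy₀A) (h.trans hy₀.symm)
  refine ⟨?_, ?_⟩
  · ext y
    simp only [mem_setOf_eq, mem_singleton_iff]
    exact ⟨fun h => key y (subset_closure h.1) h.2, fun h => h ▸ ⟨hy₀A, hy₀⟩⟩
  · ext y
    simp only [mem_setOf_eq, mem_singleton_iff]
    exact ⟨fun h => key y h.1 h.2, fun h => h ▸ ⟨subset_closure hy₀A, hy₀⟩⟩

end Monotone

/-! ### Thom cells -/

/-- Every sign is `0`, `-1` or `1`. [folklore] -/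
theorem signType_cases (s : SignType) : s = 0 ∨ s = -1 ∨ s = 1 := by
  cases s <;> decide

section Cell

variable {p : ℝ[X]} {σ : ℕ → SignType}

/-- Peeling off the condition on `p` itself: for `deg p ≠ 0`, `y` lies in the Thom cell of `p` for
`σ` iff `sign p(y) = σ 0` and `y` lies in the Thom cell of `p'` for the shifted condition
`j ↦ σ (j + 1)`. [cite: BasuPollackRoy2006, Lemma 5.33 (Thom's lemma), proof] -/
theorem mem_cell_iff (hp : p.natDegree ≠ 0) {y : ℝ} :
    (∀ j ≤ p.natDegree, SignType.sign ((derivative^[j] p).eval y) = σ j) ↔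
      SignType.sign (p.eval y) = σ 0 ∧
        ∀ j ≤ (derivative p).natDegree,
          SignType.sign ((derivative^[j] (derivative p)).eval y) = σ (j + 1) := by
  rw [natDegree_derivative]
  constructor
  · intro h
    refine ⟨by simpa using h 0 (Nat.zero_le _), fun j hj => ?_⟩
    have := h (j + 1) (by omega)
    simpa only [Function.iterate_succ_apply] using this
  · rintro ⟨h0, h⟩ j hj
    rcases j with _ | j
    · simpa using h0
    · have := h j (by omega)
      simpa only [Function.iterate_succ_apply] using this

/-- The same peeling for the relaxed cell. [cite: BasuPollackRoy2006, Lemma 5.33, proof] -/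
theorem mem_relax_iff (hp : p.natDegree ≠ 0) {y : ℝ} :
    (∀ j ≤ p.natDegree, SignType.sign ((derivative^[j] p).eval y) = σ j ∨
        (derivative^[j] p).eval y = 0) ↔
      (SignType.sign (p.eval y) = σ 0 ∨ p.eval y = 0) ∧
        ∀ j ≤ (derivative p).natDegree,
          SignType.sign ((derivative^[j] (derivative p)).eval y) = σ (j + 1) ∨
            (derivative^[j] (derivative p)).eval y = 0 := by
  rw [natDegree_derivative]
  constructor
  · intro h
    refine ⟨by simpa using h 0 (Nat.zero_le _), fun j hj => ?_⟩
    have := h (j + 1) (by omega)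
    simpa only [Function.iterate_succ_apply] using this
  · rintro ⟨h0, h⟩ j hj
    rcases j with _ | j
    · simpa using h0
    · have := h j (by omega)
      simpa only [Function.iterate_succ_apply] using this

/-- A Thom cell with at least two points is open: each condition `sign p⁽ʲ⁾(y) = σ j` with
`σ j ≠ 0` is open, and a condition with `σ j = 0` holding on an infinite set forces `p⁽ʲ⁾ = 0`,
so that it holds everywhere. [cite: BasuPollackRoy2006, Lemma 5.33, proof] -/
theorem isOpen_cell_of_infinite
    (hinf : {y | ∀ j ≤ p.natDegree, SignType.sign ((derivative^[j] p).eval y) = σ j}.Infinite) :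
    IsOpen {y | ∀ j ≤ p.natDegree, SignType.sign ((derivative^[j] p).eval y) = σ j} := by
  have hrepr : {y | ∀ j ≤ p.natDegree, SignType.sign ((derivative^[j] p).eval y) = σ j} =
      ⋂ j ∈ Finset.range (p.natDegree + 1),
        {y | SignType.sign ((derivative^[j] p).eval y) = σ j} := by
    ext y
    simp only [mem_setOf_eq, mem_iInter, Finset.mem_range, Nat.lt_succ_iff]
  rw [hrepr]
  refine isOpen_biInter_finset fun j hj => ?_
  have hj' : j ≤ p.natDegree := by simpa [Nat.lt_succ_iff] using hj
  rcases signType_cases (σ j) with hσ | hσ | hσ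
  · -- `σ j = 0`: the `j`-th derivative vanishes on an infinite set, hence is zero
    have hzero : derivative^[j] p = 0 := by
      refine eq_zero_of_infinite_isRoot _ (hinf.mono fun y hy => ?_)
      have := hy j hj'
      rw [hσ, sign_eq_zero_iff] at this
      exact this
    have : {y : ℝ | SignType.sign ((derivative^[j] p).eval y) = σ j} = univ := by
      ext y
      simp [hzero, hσ]
    rw [this]
    exact isOpen_univ
  · have : {y : ℝ | SignType.sign ((derivative^[j] p).eval y) = σ j} =
        (fun y => (derivative^[j] p).eval y) ⁻¹' Iio 0 := by
      ext y
      rw [mem_setOf_eq, hσ]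
      exact sign_eq_neg_one_iff
    rw [this]
    exact (Polynomial.continuous _).isOpen_preimage _ isOpen_Iio
  · have : {y : ℝ | SignType.sign ((derivative^[j] p).eval y) = σ j} =
        (fun y => (derivative^[j] p).eval y) ⁻¹' Ioi 0 := by
      ext y
      rw [mem_setOf_eq, hσ]
      exact sign_eq_one_iff
    rw [this]
    exact (Polynomial.continuous _).isOpen_preimage _ isOpen_Ioi

end Cell

/-! ### Thom's lemma -/

/-- **Thom's lemma** (for one polynomial and all its derivatives). For a real polynomial `p` and a
sign condition `σ` on `p, p', …, p⁽ᵈ⁾` (`d = deg p`), if the Thom cell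
`C = {y | ∀ j ≤ d, sign p⁽ʲ⁾(y) = σ j}` is non-empty then it is preconnected (a point or an open
interval) and its closure is the relaxed cell `{y | ∀ j ≤ d, sign p⁽ʲ⁾(y) = σ j ∨ p⁽ʲ⁾(y) = 0}`.
Induction on `d` as printed: `C` is the cell of `p'` for the shifted condition cut by the condition
on `p`, and `p` is strictly monotone on the closure of the cell of `p'` when that cell is an
interval. [cite: BasuPollackRoy2006, Lemma 5.33 (Thom's lemma)] -/
theorem isPreconnected_and_closure_eq :
    ∀ (n : ℕ) (p : ℝ[X]) (σ : ℕ → SignType), p.natDegree = n →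
      {y | ∀ j ≤ p.natDegree, SignType.sign ((derivative^[j] p).eval y) = σ j}.Nonempty →
      IsPreconnected {y | ∀ j ≤ p.natDegree, SignType.sign ((derivative^[j] p).eval y) = σ j} ∧
        closure {y | ∀ j ≤ p.natDegree, SignType.sign ((derivative^[j] p).eval y) = σ j} =
          {y | ∀ j ≤ p.natDegree, SignType.sign ((derivative^[j] p).eval y) = σ j ∨
            (derivative^[j] p).eval y = 0} := by
  intro n
  induction n with
  | zero =>
    intro p σ hp hne
    -- `p` is a constant: the cell is everything
    obtain ⟨y₀, hy₀⟩ := hne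
    have hall : ∀ y : ℝ, ∀ j ≤ p.natDegree, SignType.sign ((derivative^[j] p).eval y) = σ j := by
      intro y j hj
      rw [hp, Nat.le_zero] at hj
      subst hj
      have h0 := hy₀ 0 (by rw [hp])
      rw [eq_C_of_natDegree_eq_zero hp] at h0 ⊢
      simpa using h0
    have huniv : {y | ∀ j ≤ p.natDegree, SignType.sign ((derivative^[j] p).eval y) = σ j} =
        univ := eq_univ_of_forall hall
    have huniv' : {y | ∀ j ≤ p.natDegree, SignType.sign ((derivative^[j] p).eval y) = σ j ∨
        (derivative^[j] p).eval y = 0} = univ :=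
      eq_univ_of_forall fun y j hj => Or.inl (hall y j hj)
    rw [huniv, huniv', closure_univ]
    exact ⟨isPreconnected_univ, rfl⟩
  | succ n ih =>
    intro p σ hp hne
    have hp0 : p.natDegree ≠ 0 := by omega
    have hp' : (derivative p).natDegree = n := by rw [natDegree_derivative, hp]; rfl
    -- the cell `A'` of `p'` for the shifted sign condition, and the induction hypothesis
    set A' : Set ℝ := {y | ∀ j ≤ (derivative p).natDegree,
      SignType.sign ((derivative^[j] (derivative p)).eval y) = σ (j + 1)} with hA'
    have hcell : {y | ∀ j ≤ p.natDegree, SignType.sign ((derivative^[j] p).eval y) = σ j} =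
        {y ∈ A' | SignType.sign (p.eval y) = σ 0} := by
      ext y
      rw [mem_setOf_eq, mem_cell_iff hp0]
      exact ⟨fun h => ⟨h.2, h.1⟩, fun h => ⟨h.2, h.1⟩⟩
    have hrelax : {y | ∀ j ≤ p.natDegree, SignType.sign ((derivative^[j] p).eval y) = σ j ∨
        (derivative^[j] p).eval y = 0} =
        {y ∈ closure A' | SignType.sign (p.eval y) = σ 0 ∨ p.eval y = 0} := by
      obtain ⟨y₁, hy₁⟩ := hne
      have hne' : A'.Nonempty := ⟨y₁, ((mem_cell_iff hp0).mp hy₁).2⟩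
      rw [(ih (derivative p) (fun j => σ (j + 1)) hp' hne').2]
      ext y
      rw [mem_setOf_eq, mem_relax_iff hp0]
      exact ⟨fun h => ⟨h.2, h.1⟩, fun h => ⟨h.2, h.1⟩⟩
    rw [hcell, hrelax]
    rw [hcell] at hne
    obtain ⟨y₁, hy₁A', hy₁⟩ := hne
    have hne' : A'.Nonempty := ⟨y₁, hy₁A'⟩
    have hconn : IsPreconnected A' := (ih (derivative p) (fun j => σ (j + 1)) hp' hne').1
    have hord : A'.OrdConnected := hconn.ordConnected
    -- the sign of `p'` on `A'` is `σ 1`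
    have hsign' : ∀ y ∈ A', SignType.sign ((derivative p).eval y) = σ 1 := fun y hy => by
      simpa using hy 0 (Nat.zero_le _)
    by_cases hsub : A'.Subsingleton
    · -- `A'` is the point `y₁`
      have hA'eq : A' = {y₁} := hsub.eq_singleton_of_mem hy₁A'
      have h1 : {y ∈ A' | SignType.sign (p.eval y) = σ 0} = {y₁} := by
        rw [hA'eq]
        ext y
        simp only [mem_setOf_eq, mem_singleton_iff]
        exact ⟨fun h => h.1, fun h => ⟨h, h ▸ hy₁⟩⟩
      have h2 : {y ∈ closure A' | SignType.sign (p.eval y) = σ 0 ∨ p.eval y = 0} = {y₁} := by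
        rw [hA'eq, closure_singleton]
        ext y
        simp only [mem_setOf_eq, mem_singleton_iff]
        exact ⟨fun h => h.1, fun h => ⟨h, Or.inl (h ▸ hy₁)⟩⟩
      rw [h1, h2, closure_singleton]
      exact ⟨isPreconnected_singleton, rfl⟩
    · -- `A'` is an infinite open interval on which `p'` has the constant sign `σ 1 ≠ 0`
      obtain ⟨a, ha, b, hb, hab⟩ := (not_subsingleton_iff.mp hsub).exists_lt
      have hinf : A'.Infinite := (Icc_infinite hab).mono (hord.out ha hb)
      have hσ1 : σ 1 ≠ 0 := by
        intro h1
        have hzero : derivative p = 0 := by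
          refine eq_zero_of_infinite_isRoot _ (hinf.mono fun y hy => ?_)
          have := hsign' y hy
          rw [h1, sign_eq_zero_iff] at this
          exact this
        rw [derivative_eq_zero] at hzero
        exact hp0 hzero
      have hopen : IsOpen A' := isOpen_cell_of_infinite hinf
      have hint : interior (closure A') ⊆ A' := interior_closure_subset hord
      have hconv : Convex ℝ (closure A') := hconn.closure.ordConnected.convex
      -- `g = (σ 1) • p` is strictly increasing on `closure A'`
      set g : ℝ → ℝ := fun y => (σ 1 : ℝ) * p.eval y with hg
      have hgc : Continuous g := continuous_const.mul (Polynomial.continuous p)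
      have hgd : ∀ y, deriv g y = (σ 1 : ℝ) * (derivative p).eval y := fun y => by
        rw [hg, deriv_const_mul _ p.differentiableAt, Polynomial.deriv]
      have hmono : StrictMonoOn g (closure A') := by
        refine strictMonoOn_of_deriv_pos hconv hgc.continuousOn fun y hy => ?_
        rw [hgd]
        have hs := hsign' y (hint hy)
        rcases signType_cases (σ 1) with h1 | h1 | h1
        · exact absurd h1 hσ1
        · rw [h1, sign_eq_neg_one_iff] at hs
          rw [h1, SignType.coe_neg_one, neg_one_mul, neg_pos]
          exact hs
        · rw [h1, sign_eq_one_iff] at hs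
          rw [h1, SignType.coe_one, one_mul]
          exact hs
      -- case analysis on `σ 1 = ±1` and `σ 0 ∈ {0, 1, -1}`
      rcases signType_cases (σ 1) with h1 | h1 | h1
      · exact absurd h1 hσ1
      · -- `σ 1 = -1`: `g = -p`
        have hgp : ∀ y, g y = -p.eval y := fun y => by
          simp [hg, h1]
        rcases signType_cases (σ 0) with h0 | h0 | h0
        · -- roots of `p` in `A'`
          have hz : g y₁ = 0 := by rw [hgp, neg_eq_zero]; exact sign_eq_zero_iff.mp (hy₁.trans h0)
          obtain ⟨e1, e2⟩ := sep_eq_zero_eq_singleton hmono hy₁A' hz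
          have h1' : {y ∈ A' | SignType.sign (p.eval y) = 0} = {y₁} := by
            rw [← e1]; ext y
            simp only [mem_setOf_eq, sign_eq_zero_iff, hgp, neg_eq_zero]
          have h2' : {y ∈ closure A' | SignType.sign (p.eval y) = 0 ∨ p.eval y = 0} = {y₁} := by
            rw [← e2]; ext y
            simp only [mem_setOf_eq, sign_eq_zero_iff, or_self, hgp, neg_eq_zero]
          rw [h0, h1', h2', closure_singleton]
          exact ⟨isPreconnected_singleton, rfl⟩
        · -- `p < 0`, i.e. `0 < g`
          have e1 : {y ∈ A' | SignType.sign (p.eval y) = -1} = {y ∈ A' | 0 < g y} := by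
            ext y; simp only [mem_setOf_eq, sign_eq_neg_one_iff, hgp, neg_pos]
          have e2 : {y ∈ closure A' | SignType.sign (p.eval y) = -1 ∨ p.eval y = 0} =
              {y ∈ closure A' | 0 ≤ g y} := by
            ext y
            simp only [mem_setOf_eq, sign_eq_neg_one_iff, hgp, neg_nonneg]
            exact and_congr_right fun _ => le_iff_lt_or_eq.symm
          rw [h0, e1, e2]
          have hne1 : {y ∈ A' | 0 < g y}.Nonempty :=
            ⟨y₁, hy₁A', by rw [hgp, neg_pos]; exact sign_eq_neg_one_iff.mp (hy₁.trans h0)⟩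
          exact ⟨(ordConnected_sep_pos hord hmono).isPreconnected,
            closure_sep_pos_eq hord hgc hmono hne1⟩
        · -- `0 < p`, i.e. `g < 0`
          have e1 : {y ∈ A' | SignType.sign (p.eval y) = 1} = {y ∈ A' | g y < 0} := by
            ext y; simp only [mem_setOf_eq, sign_eq_one_iff, hgp, neg_lt_zero]
          have e2 : {y ∈ closure A' | SignType.sign (p.eval y) = 1 ∨ p.eval y = 0} =
              {y ∈ closure A' | g y ≤ 0} := by
            ext y
            simp only [mem_setOf_eq, sign_eq_one_iff, hgp, neg_nonpos]
            exact and_congr_right fun _ => by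
              rw [le_iff_lt_or_eq, eq_comm]
          rw [h0, e1, e2]
          have hne1 : {y ∈ A' | g y < 0}.Nonempty :=
            ⟨y₁, hy₁A', by rw [hgp, neg_lt_zero]; exact sign_eq_one_iff.mp (hy₁.trans h0)⟩
          exact ⟨(ordConnected_sep_neg hord hmono).isPreconnected,
            closure_sep_neg_eq hord hgc hmono hne1⟩
      · -- `σ 1 = 1`: `g = p`
        have hgp : ∀ y, g y = p.eval y := fun y => by
          simp [hg, h1]
        rcases signType_cases (σ 0) with h0 | h0 | h0
        · have hz : g y₁ = 0 := by rw [hgp]; exact sign_eq_zero_iff.mp (hy₁.trans h0)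
          obtain ⟨e1, e2⟩ := sep_eq_zero_eq_singleton hmono hy₁A' hz
          have h1' : {y ∈ A' | SignType.sign (p.eval y) = 0} = {y₁} := by
            rw [← e1]; ext y
            simp only [mem_setOf_eq, sign_eq_zero_iff, hgp]
          have h2' : {y ∈ closure A' | SignType.sign (p.eval y) = 0 ∨ p.eval y = 0} = {y₁} := by
            rw [← e2]; ext y
            simp only [mem_setOf_eq, sign_eq_zero_iff, or_self, hgp]
          rw [h0, h1', h2', closure_singleton]
          exact ⟨isPreconnected_singleton, rfl⟩
        · -- `p < 0`, i.e. `g < 0`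
          have e1 : {y ∈ A' | SignType.sign (p.eval y) = -1} = {y ∈ A' | g y < 0} := by
            ext y; simp only [mem_setOf_eq, sign_eq_neg_one_iff, hgp]
          have e2 : {y ∈ closure A' | SignType.sign (p.eval y) = -1 ∨ p.eval y = 0} =
              {y ∈ closure A' | g y ≤ 0} := by
            ext y
            simp only [mem_setOf_eq, sign_eq_neg_one_iff, hgp]
            exact and_congr_right fun _ => le_iff_lt_or_eq.symm
          rw [h0, e1, e2]
          have hne1 : {y ∈ A' | g y < 0}.Nonempty :=
            ⟨y₁, hy₁A', by rw [hgp]; exact sign_eq_neg_one_iff.mp (hy₁.trans h0)⟩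
          exact ⟨(ordConnected_sep_neg hord hmono).isPreconnected,
            closure_sep_neg_eq hord hgc hmono hne1⟩
        · -- `0 < p`, i.e. `0 < g`
          have e1 : {y ∈ A' | SignType.sign (p.eval y) = 1} = {y ∈ A' | 0 < g y} := by
            ext y; simp only [mem_setOf_eq, sign_eq_one_iff, hgp]
          have e2 : {y ∈ closure A' | SignType.sign (p.eval y) = 1 ∨ p.eval y = 0} =
              {y ∈ closure A' | 0 ≤ g y} := by
            ext y
            simp only [mem_setOf_eq, sign_eq_one_iff, hgp]
            exact and_congr_right fun _ => by
              rw [le_iff_lt_or_eq, eq_comm]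
          rw [h0, e1, e2]
          have hne1 : {y ∈ A' | 0 < g y}.Nonempty :=
            ⟨y₁, hy₁A', by rw [hgp]; exact sign_eq_one_iff.mp (hy₁.trans h0)⟩
          exact ⟨(ordConnected_sep_pos hord hmono).isPreconnected,
            closure_sep_pos_eq hord hgc hmono hne1⟩

/-- **Thom's lemma, root form.** If `p ≠ 0`, `σ 0 = 0` and `y₀` lies in the Thom cell of `p` for
`σ` (so `y₀` is a root of `p` singled out by the signs of the derivatives of `p` at `y₀`), then both
the cell and the relaxed cell are the single point `{y₀}`: the cell is a preconnected set of roots,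
hence a point, and the relaxed cell is its closure.
[cite: BasuPollackRoy2006, Lemma 5.33 (Thom's lemma)] -/
theorem eq_singleton_of_mem {p : ℝ[X]} {σ : ℕ → SignType} (hp : p ≠ 0) (hσ : σ 0 = 0) {y₀ : ℝ}
    (hy₀ : ∀ j ≤ p.natDegree, SignType.sign ((derivative^[j] p).eval y₀) = σ j) :
    {y | ∀ j ≤ p.natDegree, SignType.sign ((derivative^[j] p).eval y) = σ j} = {y₀} ∧
      {y | ∀ j ≤ p.natDegree, SignType.sign ((derivative^[j] p).eval y) = σ j ∨
        (derivative^[j] p).eval y = 0} = {y₀} := by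
  obtain ⟨hconn, hcl⟩ := isPreconnected_and_closure_eq p.natDegree p σ rfl ⟨y₀, hy₀⟩
  -- the cell consists of roots of `p`, a finite set
  have hfin : {y | ∀ j ≤ p.natDegree, SignType.sign ((derivative^[j] p).eval y) = σ j}.Finite := by
    refine (p.finite_setOf_isRoot hp).subset fun y hy => ?_
    have := hy 0 (Nat.zero_le _)
    rw [hσ, sign_eq_zero_iff] at this
    simpa using this
  -- a finite preconnected subset of `ℝ` containing `y₀` is `{y₀}`
  have hsub : {y | ∀ j ≤ p.natDegree,
      SignType.sign ((derivative^[j] p).eval y) = σ j}.Subsingleton := by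
    by_contra h
    obtain ⟨a, ha, b, hb, hab⟩ := (not_subsingleton_iff.mp h).exists_lt
    exact (Icc_infinite hab).mono (hconn.ordConnected.out ha hb) hfin
  have heq := hsub.eq_singleton_of_mem hy₀
  refine ⟨heq, ?_⟩
  rw [← hcl, heq, closure_singleton]

end Thom

end Literature.ModelTheory.ExponentialFields
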